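import Summits.SmoothPoincare4.SmoothPoincare4.Theses.CommonDualRelay

/-!
# Crux `DualPresentation` (stmt-SmoothPoincare4-15791) — split piece `DualUpgrade`
# (stmt-SmoothPoincare4-18145): birth skeleton `split-dualupgrade`

Line: the two standard pictures.  Two registered stubs — the `S⁴` side and the `M` side of the
geometric-dual upgrade — and the kernel-checked composition
`DualUpgrade_of : DualUpgrade` — proved from the two stubs used BY NAME (the only `sorry`s).

* `stub_sphereSideDual` (Kirby 1996 §1–2, Gompf–Stipsicz §5.2 + the parity argument): reversing the
  surgery `N ↝ S⁴` along `P`, `N ≅ S⁴ ∪ (k two-handles on a framed unlink)` with `P` the cores;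
  `Aᵢ·Pⱼ = ±δᵢⱼ`, `Aᵢ² = 0` force the even framings, so `N ≅ #k(S²×S²)` and the other factor spheres,
  corrected to square `0` and re-parametrised to sign `+1`, form a framed system `C` geometrically
  dual to `P` with surgery along `C` giving `S⁴`.  No `M` enters.
* `stub_mSideDual` (same picture from the `M` side, needs `H₂(M) = 0`, i.e. `M ≃ₕ S⁴`): reversing the
  surgery `N ↝ M` along `A` (circles null-isotopic in the simply connected `M`), `N ≅ M # k(S²-bundles)`
  with `A` the fibres; `Pᵢ·Aⱼ = ±δᵢⱼ`, `Pᵢ² = 0`, `H₂(M) = 0` force the even framings, and the sections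
  give, for ANY prescribed orientation `o` of `S²`, a framed system `G` geometrically dual to `A`.
-/

set_option linter.dupNamespace false

namespace Summit.SmoothPoincare4.SmoothPoincare4.Cruxes.DualPresentation.SplitDualUpgrade

open scoped Manifold ContDiff Topology ContinuousMap
open Literature.Topology.FourManifolds
open Summit.SmoothPoincare4.SmoothPoincare4.Theses.CommonDualRelay

/-- Local notation: the standard spheres. -/
local notation "𝕊⁴" => (Metric.sphere (0 : EuclideanSpace ℝ (Fin 5)) 1)
local notation "𝕊²" => (Metric.sphere (0 : EuclideanSpace ℝ (Fin 3)) 1)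

/-- STUB (the `S⁴` side; Kirby 1996 §1–2, Gompf–Stipsicz 1999 §5.2, parity): if surgery along the framed
`k`-system `P` of the closed simply connected `N` gives `S⁴` and a framed `k`-system `A` is
algebraically dual to `P`, then for some orientation `o` of `S²` there is a framed `k`-system `C`
geometrically dual to `P` (signs `+1` w.r.t. `o, o, oN`) with surgery along `C` giving `S⁴`. -/
theorem stub_sphereSideDual :
    ∀ (N : Type) [TopologicalSpace N] [T2Space N] [SecondCountableTopology N]
      [ChartedSpace (EuclideanSpace ℝ (Fin 4)) N] [IsManifold (𝓡 4) ∞ N] [CompactSpace N]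
      [SimplyConnectedSpace N] (oN : SmoothOrientation (𝓡 4) N) (oS oP : SmoothOrientation (𝓡 2) 𝕊²)
      (k : ℕ) (A P : FramedSphereFamily (𝓡 4) N (Fin k) 2 2),
      IsAlgebraicallyDual (𝓡 2) (𝓡 2) (𝓡 4) two_add_two_eq_four oS oP oN A.sphere P.sphere →
      P.IsSurgery (𝓡 4) 𝕊⁴ →
      ∃ (o : SmoothOrientation (𝓡 2) 𝕊²) (C : FramedSphereFamily (𝓡 4) N (Fin k) 2 2),
        IsGeometricallyDual (𝓡 2) (𝓡 2) (𝓡 4) two_add_two_eq_four o o oN C.sphere P.sphere ∧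
        C.IsSurgery (𝓡 4) 𝕊⁴ := by
  sorry

/-- STUB (the `M` side; needs `H₂(M) = 0`): if moreover surgery along `A` gives the homotopy 4-sphere
`M ≃ₕ S⁴`, then for every orientation `o` of `S²` there is a framed `k`-system `G` geometrically dual to
`A` (signs `+1` w.r.t. `o, o, oN`; the parametrisation of `G` absorbs the sign). -/
theorem stub_mSideDual :
    ∀ (M : Type) [TopologicalSpace M] [T2Space M] [SecondCountableTopology M]
      [ChartedSpace (EuclideanSpace ℝ (Fin 4)) M] [IsManifold (𝓡 4) ∞ M] (_ : M ≃ₕ 𝕊⁴)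
      (N : Type) [TopologicalSpace N] [T2Space N] [SecondCountableTopology N]
      [ChartedSpace (EuclideanSpace ℝ (Fin 4)) N] [IsManifold (𝓡 4) ∞ N] [CompactSpace N]
      [SimplyConnectedSpace N] (oN : SmoothOrientation (𝓡 4) N) (oS oP o : SmoothOrientation (𝓡 2) 𝕊²)
      (k : ℕ) (A P : FramedSphereFamily (𝓡 4) N (Fin k) 2 2),
      IsAlgebraicallyDual (𝓡 2) (𝓡 2) (𝓡 4) two_add_two_eq_four oS oP oN A.sphere P.sphere →
      A.IsSurgery (𝓡 4) M →
      ∃ G : FramedSphereFamily (𝓡 4) N (Fin k) 2 2,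
        IsGeometricallyDual (𝓡 2) (𝓡 2) (𝓡 4) two_add_two_eq_four o o oN G.sphere A.sphere := by
  sorry

/-- COMPOSITION (kernel-checked; the only `sorry`s are inside the two declared stubs, used here BY NAME): the `S⁴`-side stub chooses `o` and `C`, the `M`-side stub
supplies `G` for that `o`. -/
theorem DualUpgrade_of :
    Summit.SmoothPoincare4.SmoothPoincare4.Theses.CommonDualRelay.DualUpgrade := by
  intro M _ _ _ _ _ e N _ _ _ _ _ _ _ oN oS oP k A P hAP hP hA
  obtain ⟨o, C, hCP, hC⟩ := stub_sphereSideDual N oN oS oP k A P hAP hP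
  obtain ⟨G, hGA⟩ := stub_mSideDual M e N oN oS oP o k A P hAP hA
  exact ⟨o, G, C, hGA, hCP, hC⟩

end Summit.SmoothPoincare4.SmoothPoincare4.Cruxes.DualPresentation.SplitDualUpgrade
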